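import Literature.NumberTheory.Transcendental.SemialgebraicMapsProofs
import HarnessLib

/-!
# Compact semialgebraic models from a finite semialgebraic atlas

Topic `Literature/ModelTheory/ExponentialFields` (semialgebraic geometry over `ℝ`; the tree's
`IsSemialgebraic`, `IsSemialgebraicMapOn`/`IsSemialgebraicFunOn`, Tarski–Seidenberg
`tarski_seidenberg_real_holds`, `semialgebraic_triangulation`). An abstract packaging of the
standard proof that **a space covered by finitely many semialgebraically compatible charts has,
around any compact set, a compact neighbourhood homeomorphic to a semialgebraic set**, with a
prescribed chartwise-semialgebraic subset going to a semialgebraic subset — the input of the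
triangulation theorem (Bochnak–Coste–Roy, *Real Algebraic Geometry*, §2.2 (semialgebraic maps,
Prop. 2.2.6–2.2.7), §9.2 (triangulation); Hironaka 1975; Łojasiewicz 1964, for complex and real
analytic/algebraic sets). Used for the complex points `X(ℂ)` of a separated `ℂ`-scheme with its
affine charts (`AlgebraicGeometry/HodgeTheory/ComplexPointsSemialgebraicCharts`).

* `SemialgAtlas.Chart M` — a chart: an open `dom ⊆ M` and `φ : M → ℝᵐ` restricting to a closed
  embedding of `dom` with semialgebraic image; `Compatible c c'` — `φ_c(dom_c ∩ dom_c')` and the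
  joint graph `{(φ_c Q, φ_c' Q)}` are semialgebraic (the transition map is semialgebraic).
* `SemialgAtlas.Ball` — a chart with a centre `z` and a radius `r > 0`; its **bump**
  `β(Q) = max (0, r - |φ Q - z|²)` on `dom`, `0` elsewhere, is continuous on `M` (`M` Hausdorff)
  with compact support ball.
* For finitely many balls `b : Fin A → Ball M`: the map `Ψ : M → ℝᴺ` with blocks
  `(β_a, β_a · (φ_a - z_a))` and the set `T_η = {Q | ∃ a, η ≤ β_a Q}`; **theorem**
  (`isCompact_tset`, `continuous_psi`, `injOn_psi`, `isSemialgebraic_image_psi`,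
  `isSemialgebraic_image_psi_inter`): for `η > 0`, pairwise compatible charts and a subset `Z`
  with `φ_a(dom_a ∩ Z)` semialgebraic for all `a`, `T_η` is compact, contains the open set
  `{∃ a, η < β_a}`, `Ψ` is continuous and injective on `T_η`, and `Ψ(T_η)`, `Ψ(T_η ∩ Z)` are
  semialgebraic (chartwise: `Ψ ∘ φ_a⁻¹` is a semialgebraic map on the semialgebraic set
  `φ_a(T_η ∩ {η ≤ β_a})`, by compatibility and closure of semialgebraic functions under
  `+, ·, |·|`; images by Tarski–Seidenberg).

Everything is proved; no named fact is introduced.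

## References

* J. Bochnak, M. Coste, M.-F. Roy, *Real Algebraic Geometry* (1998), Def. 2.2.5, Prop. 2.2.6,
  Prop. 2.2.7, Thm. 9.2.1. [BochnakCosteRoy1998]
* S. Łojasiewicz, *Triangulation of semi-analytic sets*, Ann. Sc. Norm. Sup. Pisa 18 (1964).
-/

noncomputable section

open Set Function MvPolynomial Topology Filter
open scoped BigOperators
open Literature.NumberTheory.Transcendental

namespace Literature.ModelTheory.ExponentialFields

namespace SemialgAtlas

/-! ### Semialgebraic functions: closure properties in the form used below -/

section Functions

variable {m : ℕ} {s t : Set (Fin m → ℝ)} {f g : (Fin m → ℝ) → ℝ}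

/-- Constants are semialgebraic functions. [cite: BochnakCosteRoy1998, §2.2] -/
theorem isSemialgebraicFunOn_const (hs : IsSemialgebraic ℝ s) (c : ℝ) :
    IsSemialgebraicFunOn ℝ s fun _ => c :=
  (isSemialgebraicFunOn_aeval hs (C c)).congr fun x _ => by simp

/-- Coordinates are semialgebraic functions. [cite: BochnakCosteRoy1998, §2.2] -/
theorem isSemialgebraicFunOn_apply (hs : IsSemialgebraic ℝ s) (i : Fin m) :
    IsSemialgebraicFunOn ℝ s fun x => x i :=
  (isSemialgebraicFunOn_aeval hs (X i)).congr fun x _ => by simp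

/-- Sums. [cite: BochnakCosteRoy1998, Prop. 2.2.6] -/
theorem saFun_add (hf : IsSemialgebraicFunOn ℝ s f) (hg : IsSemialgebraicFunOn ℝ s g) :
    IsSemialgebraicFunOn ℝ s fun x => f x + g x :=
  IsSemialgebraicFunOn.add_holds hf hg

/-- Differences. [cite: BochnakCosteRoy1998, Prop. 2.2.6] -/
theorem saFun_sub (hf : IsSemialgebraicFunOn ℝ s f) (hg : IsSemialgebraicFunOn ℝ s g) :
    IsSemialgebraicFunOn ℝ s fun x => f x - g x :=
  IsSemialgebraicFunOn.sub_holds hf hg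

/-- Products. [cite: BochnakCosteRoy1998, Prop. 2.2.6] -/
theorem saFun_mul (hf : IsSemialgebraicFunOn ℝ s f) (hg : IsSemialgebraicFunOn ℝ s g) :
    IsSemialgebraicFunOn ℝ s fun x => f x * g x :=
  IsSemialgebraicFunOn.mul_holds hf hg

/-- Finite sums. [cite: BochnakCosteRoy1998, Prop. 2.2.6] -/
theorem isSemialgebraicFunOn_finset_sum (hs : IsSemialgebraic ℝ s) {ι : Type*} (I : Finset ι)
    (F : ι → (Fin m → ℝ) → ℝ) (hF : ∀ i ∈ I, IsSemialgebraicFunOn ℝ s (F i)) :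
    IsSemialgebraicFunOn ℝ s fun x => ∑ i ∈ I, F i x := by
  classical
  induction I using Finset.induction_on with
  | empty =>
    simp only [Finset.sum_empty]
    exact isSemialgebraicFunOn_const hs 0
  | insert i I hi ih =>
    simp only [Finset.sum_insert hi]
    exact saFun_add (hF i (Finset.mem_insert_self i I))
      (ih fun j hj => hF j (Finset.mem_insert_of_mem hj))

/-- `max (0, f)` of a semialgebraic function is semialgebraic (`= (f + |f|) / 2`).
[cite: BochnakCosteRoy1998, Prop. 2.2.6] -/
theorem saFun_posPart (hs : IsSemialgebraic ℝ s) (hf : IsSemialgebraicFunOn ℝ s f) :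
    IsSemialgebraicFunOn ℝ s fun x => max 0 (f x) := by
  have h : IsSemialgebraicFunOn ℝ s fun x => (1 / 2 : ℝ) * (f x + |f x|) :=
    saFun_mul (isSemialgebraicFunOn_const hs _) (saFun_add hf hf.abs)
  refine h.congr fun x _ => ?_
  show (1 / 2 : ℝ) * (f x + |f x|) = max 0 (f x)
  rcases le_or_gt 0 (f x) with h0 | h0
  · rw [max_eq_right h0, abs_of_nonneg h0]; ring
  · rw [max_eq_left h0.le, abs_of_neg h0]; ring

/-- **Gluing**: a function semialgebraic on each of finitely many semialgebraic pieces is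
semialgebraic on their union. [cite: BochnakCosteRoy1998, §2.2] -/
theorem isSemialgebraicFunOn_biUnion {ι : Type*} (I : Finset ι) (S : ι → Set (Fin m → ℝ))
    (hf : ∀ i ∈ I, IsSemialgebraicFunOn ℝ (S i) f) : IsSemialgebraicFunOn ℝ (⋃ i ∈ I, S i) f := by
  unfold IsSemialgebraicFunOn at hf ⊢
  have : {z : Fin (m + 1) → ℝ | ∃ x ∈ ⋃ i ∈ I, S i, z = Fin.snoc x (f x)} =
      ⋃ i ∈ I, {z : Fin (m + 1) → ℝ | ∃ x ∈ S i, z = Fin.snoc x (f x)} := by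
    ext z
    simp only [mem_setOf_eq, mem_iUnion, exists_prop]
    constructor
    · rintro ⟨x, ⟨i, hi, hx⟩, rfl⟩
      exact ⟨i, hi, x, hx, rfl⟩
    · rintro ⟨i, hi, x, hx, rfl⟩
      exact ⟨x, ⟨i, hi, hx⟩, rfl⟩
  rw [this]
  exact IsSemialgebraic.biUnion I _ hf

/-- **Extension by zero**: `f` semialgebraic on a semialgebraic `t ⊆ s` and vanishing on `s ∖ t`
is semialgebraic on `s`. [cite: BochnakCosteRoy1998, §2.2] -/
theorem saFun_of_eq_zero_off (hs : IsSemialgebraic ℝ s) (ht : IsSemialgebraic ℝ t)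
    (hf : IsSemialgebraicFunOn ℝ t f) (h0 : ∀ x ∈ s, x ∉ t → f x = 0) (hts : t ⊆ s) :
    IsSemialgebraicFunOn ℝ s f := by
  have h1 : IsSemialgebraicFunOn ℝ (s \ t) f :=
    (isSemialgebraicFunOn_const (hs.diff ht) 0).congr fun x hx => (h0 x hx.1 hx.2).symm
  have h2 := isSemialgebraicFunOn_biUnion (f := f) ({true, false} : Finset Bool)
    (fun b => if b then t else s \ t) (by
      intro b _
      cases b
      · simpa using h1
      · simpa using hf)
  have hU : (⋃ b ∈ ({true, false} : Finset Bool), (if b then t else s \ t : Set (Fin m → ℝ))) = s := by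
    ext x
    simp only [Finset.mem_insert, Finset.mem_singleton, mem_iUnion, exists_prop]
    constructor
    · rintro ⟨b, -, hb⟩
      cases b
      · exact (show x ∈ s \ t from hb).1
      · exact hts (show x ∈ t from hb)
    · intro hx
      by_cases hxt : x ∈ t
      · exact ⟨true, Or.inl rfl, by simpa using hxt⟩
      · exact ⟨false, Or.inr rfl, show x ∈ s \ t from ⟨hx, hxt⟩⟩
  rwa [hU] at h2

/-- The coordinate functions of a semialgebraic map are semialgebraic (Tarski–Seidenberg).
[cite: BochnakCosteRoy1998, §2.2] -/
theorem saMap_apply {n : ℕ} {F : (Fin m → ℝ) → Fin n → ℝ} (hs : IsSemialgebraic ℝ s)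
    (hF : IsSemialgebraicMapOn ℝ s F) (j : Fin n) : IsSemialgebraicFunOn ℝ s fun x => F x j :=
  (isSemialgebraicMapOn_iff_forall_holds hs).1 hF j

end Functions

/-! ### Sums of squares -/

section SumSq

variable {m : ℕ}

/-- `|w|² = Σ wᵢ²`. [folklore] -/
def sumSq (w : Fin m → ℝ) : ℝ := ∑ i, w i ^ 2

/-- The polynomial `Σ (Xᵢ - zᵢ)²`. [folklore] -/
def sumSqPoly (z : Fin m → ℝ) : MvPolynomial (Fin m) ℝ := ∑ i, (X i - C (z i)) ^ 2

/-- `sumSqPoly z` evaluates to `|w - z|²`. [folklore] -/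
@[simp] theorem aeval_sumSqPoly (z w : Fin m → ℝ) : aeval w (sumSqPoly z) = sumSq (w - z) := by
  simp [sumSqPoly, sumSq, map_sum]

/-- `|w|² ≥ 0`. [folklore] -/
theorem sumSq_nonneg (w : Fin m → ℝ) : 0 ≤ sumSq w :=
  Finset.sum_nonneg fun i _ => sq_nonneg (w i)

/-- `wᵢ² ≤ |w|²`. [folklore] -/
theorem sq_le_sumSq (w : Fin m → ℝ) (i : Fin m) : w i ^ 2 ≤ sumSq w :=
  Finset.single_le_sum (f := fun i => w i ^ 2) (fun j _ => sq_nonneg (w j)) (Finset.mem_univ i)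

/-- `|w|² = 0 ↔ w = 0`. [folklore] -/
theorem sumSq_eq_zero_iff (w : Fin m → ℝ) : sumSq w = 0 ↔ w = 0 := by
  constructor
  · intro h
    funext i
    have h1 := sq_le_sumSq w i
    rw [h] at h1
    have : w i ^ 2 = 0 := le_antisymm h1 (sq_nonneg _)
    exact pow_eq_zero_iff (n := 2) (by norm_num) |>.1 this
  · rintro rfl
    simp [sumSq]

/-- `|·|²` is continuous. [folklore] -/
theorem continuous_sumSq : Continuous (sumSq : (Fin m → ℝ) → ℝ) :=
  continuous_finsetSum _ fun i _ => (continuous_apply i).pow 2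

/-- Closed `|·|²`-balls are compact. [folklore] -/
theorem isCompact_setOf_sumSq_le (z : Fin m → ℝ) (r : ℝ) : IsCompact {w : Fin m → ℝ | sumSq (w - z) ≤ r} := by
  refine Metric.isCompact_of_isClosed_isBounded ?_ ?_
  · exact isClosed_le (continuous_sumSq.comp (continuous_id.sub continuous_const)) continuous_const
  · refine (Metric.isBounded_closedBall (x := z) (r := Real.sqrt r)).subset fun w hw => ?_
    rw [Metric.mem_closedBall, dist_pi_le_iff (Real.sqrt_nonneg r)]
    intro i
    rw [Real.dist_eq]
    have h1 : (w i - z i) ^ 2 ≤ r := (sq_le_sumSq (w - z) i).trans hw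
    calc |w i - z i| = Real.sqrt ((w i - z i) ^ 2) := (Real.sqrt_sq_eq_abs _).symm
      _ ≤ Real.sqrt r := Real.sqrt_le_sqrt h1

end SumSq

/-! ### Charts and balls -/

variable {M : Type*} [TopologicalSpace M]

/-- A **semialgebraic chart** on `M`: an open `dom` and `φ : M → ℝᵐ` restricting to a closed
embedding of `dom` whose image is semialgebraic. [cite: BochnakCosteRoy1998, §2.2] -/
structure Chart (M : Type*) [TopologicalSpace M] where
  /-- the chart domain -/
  dom : Set M
  /-- it is open -/
  isOpen_dom : IsOpen dom
  /-- the number of real coordinates -/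
  m : ℕ
  /-- the coordinate map (arbitrary off `dom`) -/
  φ : M → Fin m → ℝ
  /-- `φ|dom` is a closed embedding -/
  isClosedEmbedding_restrict : IsClosedEmbedding (dom.restrict φ)
  /-- `φ(dom)` is semialgebraic -/
  isSemialgebraic_image : IsSemialgebraic ℝ (φ '' dom)

namespace Chart

variable (c : Chart M)

/-- The coordinates are continuous on the domain. [folklore] -/
theorem continuousOn : ContinuousOn c.φ c.dom :=
  continuousOn_iff_continuous_restrict.2 c.isClosedEmbedding_restrict.continuous

/-- The coordinates are injective on the domain. [folklore] -/
theorem injOn : InjOn c.φ c.dom := fun x hx y hy h =>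
  congrArg Subtype.val (c.isClosedEmbedding_restrict.injective (a₁ := ⟨x, hx⟩) (a₂ := ⟨y, hy⟩) h)

/-- Compact sets of coordinates pull back to compact subsets of the domain. [folklore] -/
theorem isCompact_setOf_mem {K : Set (Fin c.m → ℝ)} (hK : IsCompact K) :
    IsCompact {Q : M | Q ∈ c.dom ∧ c.φ Q ∈ K} := by
  have h1 : IsCompact ((c.dom.restrict c.φ) ⁻¹' K) := c.isClosedEmbedding_restrict.isCompact_preimage hK
  have h2 := h1.image continuous_subtype_val
  convert h2 using 1
  ext Q
  constructor
  · rintro ⟨hQ, hK'⟩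
    exact ⟨⟨Q, hQ⟩, hK', rfl⟩
  · rintro ⟨Q', hQ', rfl⟩
    exact ⟨Q'.2, hQ'⟩

/-- The inverse chart `φ(dom) → dom` (extended arbitrarily). [folklore] -/
def inv [Nonempty M] : (Fin c.m → ℝ) → M := invFunOn c.φ c.dom

/-- `inv (φ Q) = Q` on the domain. [folklore] -/
theorem inv_apply [Nonempty M] {Q : M} (hQ : Q ∈ c.dom) : c.inv (c.φ Q) = Q :=
  c.injOn.leftInvOn_invFunOn hQ

/-- `inv w ∈ dom` and `φ (inv w) = w` for `w ∈ φ(dom)`. [folklore] -/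
theorem inv_mem [Nonempty M] {w : Fin c.m → ℝ} (hw : w ∈ c.φ '' c.dom) : c.inv w ∈ c.dom ∧ c.φ (c.inv w) = w := by
  obtain ⟨Q, hQ, rfl⟩ := hw
  rw [c.inv_apply hQ]
  exact ⟨hQ, rfl⟩

/-- Images of subsets of the domain, through the inverse chart. [folklore] -/
theorem image_eq_image_inv [Nonempty M] {N : Type*} (g : M → N) {A : Set M} (hA : A ⊆ c.dom) :
    g '' A = (g ∘ c.inv) '' (c.φ '' A) := by
  rw [Set.image_image]
  refine Set.image_congr fun Q hQ => ?_
  simp only [comp_apply, c.inv_apply (hA hQ)]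

/-- **Compatibility** of two charts: the coordinate image of the overlap and the joint graph of the
two coordinate maps on it are semialgebraic (i.e. the transition map is semialgebraic).
[cite: BochnakCosteRoy1998, Def. 2.2.5] -/
def Compatible (c c' : Chart M) : Prop :=
  IsSemialgebraic ℝ (c.φ '' (c.dom ∩ c'.dom)) ∧
    IsSemialgebraic ℝ {z : Fin (c.m + c'.m) → ℝ | ∃ Q ∈ c.dom ∩ c'.dom, z = Fin.append (c.φ Q) (c'.φ Q)}

/-- Compatibility makes the transition map `φ' ∘ φ⁻¹` semialgebraic on `φ(dom ∩ dom')`.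
[cite: BochnakCosteRoy1998, Def. 2.2.5] -/
theorem Compatible.isSemialgebraicMapOn [Nonempty M] {c c' : Chart M} (h : Compatible c c') :
    IsSemialgebraicMapOn ℝ (c.φ '' (c.dom ∩ c'.dom)) (c'.φ ∘ c.inv) := by
  unfold IsSemialgebraicMapOn
  convert h.2 using 1
  ext z
  simp only [mem_setOf_eq, comp_apply]
  constructor
  · rintro ⟨w, ⟨Q, hQ, rfl⟩, rfl⟩
    exact ⟨Q, hQ, by rw [c.inv_apply hQ.1]⟩
  · rintro ⟨Q, hQ, rfl⟩
    exact ⟨c.φ Q, ⟨Q, hQ, rfl⟩, by rw [c.inv_apply hQ.1]⟩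

/-- Conversely, a semialgebraic overlap image and a semialgebraic transition map give
compatibility. [cite: BochnakCosteRoy1998, Def. 2.2.5] -/
theorem compatible_of_isSemialgebraicMapOn [Nonempty M] {c c' : Chart M}
    (h1 : IsSemialgebraic ℝ (c.φ '' (c.dom ∩ c'.dom)))
    (h2 : IsSemialgebraicMapOn ℝ (c.φ '' (c.dom ∩ c'.dom)) (c'.φ ∘ c.inv)) : Compatible c c' := by
  refine ⟨h1, ?_⟩
  unfold IsSemialgebraicMapOn at h2
  convert h2 using 1
  ext z
  simp only [mem_setOf_eq, comp_apply]
  constructor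
  · rintro ⟨Q, hQ, rfl⟩
    exact ⟨c.φ Q, ⟨Q, hQ, rfl⟩, by rw [c.inv_apply hQ.1]⟩
  · rintro ⟨w, ⟨Q, hQ, rfl⟩, rfl⟩
    exact ⟨Q, hQ, by rw [c.inv_apply hQ.1]⟩

/-- Over an empty space all charts are compatible. [folklore] -/
theorem compatible_of_isEmpty [IsEmpty M] (c c' : Chart M) : Compatible c c' := by
  constructor
  · rw [Set.eq_empty_of_isEmpty (c.dom ∩ c'.dom), image_empty]
    exact isSemialgebraic_empty
  · have : {z : Fin (c.m + c'.m) → ℝ | ∃ Q ∈ c.dom ∩ c'.dom, z = Fin.append (c.φ Q) (c'.φ Q)} = ∅ := by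
      ext z
      simp only [mem_setOf_eq, mem_empty_iff_false, iff_false, not_exists, not_and]
      intro Q
      exact isEmptyElim Q
    rw [this]
    exact isSemialgebraic_empty

/-- The coordinates of a compatible chart are semialgebraic functions of the coordinates.
[cite: BochnakCosteRoy1998, §2.2] -/
theorem Compatible.isSemialgebraicFunOn_apply [Nonempty M] {c c' : Chart M} (h : Compatible c c')
    (j : Fin c'.m) : IsSemialgebraicFunOn ℝ (c.φ '' (c.dom ∩ c'.dom)) fun w => c'.φ (c.inv w) j :=
  saMap_apply h.1 h.isSemialgebraicMapOn j

end Chart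

/-- A **ball datum**: a chart, a centre and a positive radius (squared). [folklore] -/
structure Ball (M : Type*) [TopologicalSpace M] where
  /-- the chart -/
  c : Chart M
  /-- the centre, in coordinates -/
  z : Fin c.m → ℝ
  /-- the radius squared -/
  r : ℝ
  /-- positivity of the radius -/
  r_pos : 0 < r

namespace Ball

variable (b : Ball M)

/-- The bump in coordinates: `max (0, r - |w - z|²)`. [folklore] -/
def bumpCoord (w : Fin b.c.m → ℝ) : ℝ := max 0 (b.r - sumSq (w - b.z))

/-- The **bump** of the ball: `max (0, r - |φ Q - z|²)` on the chart domain, `0` elsewhere.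
[folklore] -/
def bump : M → ℝ := b.c.dom.indicator fun Q => b.bumpCoord (b.c.φ Q)

/-- The closed support ball `{Q ∈ dom | |φ Q - z|² ≤ r}`. [folklore] -/
def closedBall : Set M := {Q | Q ∈ b.c.dom ∧ sumSq (b.c.φ Q - b.z) ≤ b.r}

/-- The bump on the chart domain. [folklore] -/
theorem bump_of_mem {Q : M} (hQ : Q ∈ b.c.dom) : b.bump Q = b.bumpCoord (b.c.φ Q) :=
  indicator_of_mem hQ _

/-- The bump off the chart domain. [folklore] -/
theorem bump_of_not_mem {Q : M} (hQ : Q ∉ b.c.dom) : b.bump Q = 0 :=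
  indicator_of_notMem hQ _

/-- The bump is non-negative. [folklore] -/
theorem bump_nonneg (Q : M) : 0 ≤ b.bump Q := by
  by_cases hQ : Q ∈ b.c.dom
  · rw [b.bump_of_mem hQ]; exact le_max_left _ _
  · rw [b.bump_of_not_mem hQ]

/-- Where the bump is positive. [folklore] -/
theorem mem_dom_of_bump_pos {Q : M} (h : 0 < b.bump Q) : Q ∈ b.c.dom := by
  by_contra hQ
  rw [b.bump_of_not_mem hQ] at h
  exact lt_irrefl _ h

/-- A positive lower bound for the bump forces the point into the support ball. [folklore] -/
theorem mem_closedBall_of_bump_pos {Q : M} (h : 0 < b.bump Q) : Q ∈ b.closedBall := by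
  have hQ := b.mem_dom_of_bump_pos h
  refine ⟨hQ, ?_⟩
  rw [b.bump_of_mem hQ, bumpCoord] at h
  rcases lt_max_iff.1 h with h' | h'
  · exact absurd h' (lt_irrefl 0)
  · linarith

/-- `η ≤ bump Q` with `η > 0` in coordinates. [folklore] -/
theorem le_bump_iff {η : ℝ} (hη : 0 < η) {Q : M} (hQ : Q ∈ b.c.dom) :
    η ≤ b.bump Q ↔ sumSq (b.c.φ Q - b.z) ≤ b.r - η := by
  rw [b.bump_of_mem hQ, bumpCoord, le_max_iff]
  constructor
  · rintro (h | h)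
    · exact absurd h (not_le.2 hη)
    · linarith
  · intro h; right; linarith

/-- The support ball is compact. [folklore] -/
theorem isCompact_closedBall : IsCompact b.closedBall :=
  b.c.isCompact_setOf_mem (isCompact_setOf_sumSq_le b.z b.r)

/-- The bump vanishes off the support ball. [folklore] -/
theorem bump_eq_zero_of_not_mem_closedBall {Q : M} (hQ : Q ∉ b.closedBall) : b.bump Q = 0 := by
  by_contra h
  exact hQ (b.mem_closedBall_of_bump_pos (lt_of_le_of_ne (b.bump_nonneg Q) (Ne.symm h)))

/-- The bump in coordinates is continuous. [folklore] -/
theorem continuous_bumpCoord : Continuous b.bumpCoord :=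
  continuous_const.max (continuous_const.sub (continuous_sumSq.comp (continuous_id.sub continuous_const)))

/-- **The bump is continuous** (for `M` Hausdorff: the support ball is compact, hence closed, and
the bump vanishes off it). [folklore] -/
theorem continuous_bump [T2Space M] : Continuous b.bump := by
  refine continuous_iff_continuousAt.2 fun Q => ?_
  by_cases hQ : Q ∈ b.c.dom
  · have h1 : ContinuousOn b.bump b.c.dom :=
      (b.continuous_bumpCoord.comp_continuousOn b.c.continuousOn).congr fun Q' hQ' => b.bump_of_mem hQ'
    exact h1.continuousAt (b.c.isOpen_dom.mem_nhds hQ)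
  · have hQB : Q ∉ b.closedBall := fun h => hQ h.1
    have hev : (fun _ => (0 : ℝ)) =ᶠ[𝓝 Q] b.bump := by
      filter_upwards [b.isCompact_closedBall.isClosed.isOpen_compl.mem_nhds hQB] with Q' hQ'
      exact (b.bump_eq_zero_of_not_mem_closedBall hQ').symm
    exact continuousAt_const.congr hev

/-- **The weighted coordinates `bump · (φⱼ - zⱼ)` are continuous** on `M`. [folklore] -/
theorem continuous_bump_mul [T2Space M] (j : Fin b.c.m) :
    Continuous fun Q => b.bump Q * (b.c.φ Q j - b.z j) := by
  refine continuous_iff_continuousAt.2 fun Q => ?_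
  by_cases hQ : Q ∈ b.c.dom
  · have h1 : ContinuousOn (fun Q => b.bump Q * (b.c.φ Q j - b.z j)) b.c.dom :=
      b.continuous_bump.continuousOn.mul
        (((continuous_apply j).comp_continuousOn b.c.continuousOn).sub continuousOn_const)
    exact h1.continuousAt (b.c.isOpen_dom.mem_nhds hQ)
  · have hQB : Q ∉ b.closedBall := fun h => hQ h.1
    have hev : (fun _ => (0 : ℝ)) =ᶠ[𝓝 Q] fun Q => b.bump Q * (b.c.φ Q j - b.z j) := by
      filter_upwards [b.isCompact_closedBall.isClosed.isOpen_compl.mem_nhds hQB] with Q' hQ'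
      rw [b.bump_eq_zero_of_not_mem_closedBall hQ', zero_mul]
    exact continuousAt_const.congr hev

/-- The block of coordinates of `Ψ` attached to the ball: `(bump, bump · (φ - z))`. [folklore] -/
def block (Q : M) : Fin (b.c.m + 1) → ℝ :=
  Fin.cons (b.bump Q) fun j => b.bump Q * (b.c.φ Q j - b.z j)

/-- First entry of the block: the bump. [folklore] -/
@[simp] theorem block_zero (Q : M) : b.block Q 0 = b.bump Q := by
  simp [block]

/-- Later entries of the block: the weighted coordinates. [folklore] -/
@[simp] theorem block_succ (Q : M) (j : Fin b.c.m) : b.block Q j.succ = b.bump Q * (b.c.φ Q j - b.z j) := by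
  simp [block]

/-- The block is continuous. [folklore] -/
theorem continuous_block [T2Space M] : Continuous b.block :=
  continuous_pi fun i => Fin.cases (by simpa using b.continuous_bump)
    (fun j => by simpa using b.continuous_bump_mul j) i

end Ball

/-! ### The global map `Ψ` and the compact neighbourhoods `T_η` -/

section Model

variable {A : ℕ} (b : Fin A → Ball M)

/-- The **model map** `Ψ : M → ℝᴺ`, `N = Σ_a (m_a + 1)`: the blocks `(β_a, β_a · (φ_a - z_a))`
laid out along `finSigmaFinEquiv`. [cite: BochnakCosteRoy1998, §9.2] -/
def psi (Q : M) : Fin (∑ a, ((b a).c.m + 1)) → ℝ := fun k =>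
  (b (finSigmaFinEquiv.symm k).1).block Q (finSigmaFinEquiv.symm k).2

/-- Components of `Ψ`. [folklore] -/
theorem psi_apply (Q : M) (a : Fin A) (i : Fin ((b a).c.m + 1)) :
    psi b Q (finSigmaFinEquiv ⟨a, i⟩) = (b a).block Q i := by
  unfold psi
  generalize hk : (finSigmaFinEquiv (n := fun a => (b a).c.m + 1)).symm
    (finSigmaFinEquiv (n := fun a => (b a).c.m + 1) ⟨a, i⟩) = k
  rw [Equiv.symm_apply_apply] at hk
  subst hk
  rfl

/-- The **compact neighbourhoods** `T_η = {Q | ∃ a, η ≤ β_a Q}`. [folklore] -/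
def tset (η : ℝ) : Set M := {Q | ∃ a, η ≤ (b a).bump Q}

/-- The piece `T_{η,a} = {Q | η ≤ β_a Q}` (inside `dom_a` for `η > 0`). [folklore] -/
def tpiece (η : ℝ) (a : Fin A) : Set M := {Q | η ≤ (b a).bump Q}

/-- `T_η` is the union of its pieces. [folklore] -/
theorem tset_eq_iUnion (η : ℝ) : tset b η = ⋃ a, tpiece b η a := by
  ext Q; simp [tset, tpiece]

/-- The pieces lie in the chart domains (`η > 0`). [folklore] -/
theorem tpiece_subset_dom {η : ℝ} (hη : 0 < η) (a : Fin A) : tpiece b η a ⊆ (b a).c.dom :=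
  fun _ hQ => (b a).mem_dom_of_bump_pos (hη.trans_le hQ)

/-- The pieces lie in the support balls (`η > 0`). [folklore] -/
theorem tpiece_subset_closedBall {η : ℝ} (hη : 0 < η) (a : Fin A) : tpiece b η a ⊆ (b a).closedBall :=
  fun _ hQ => (b a).mem_closedBall_of_bump_pos (hη.trans_le hQ)

/-- **`Ψ` is continuous.** [folklore] -/
theorem continuous_psi [T2Space M] : Continuous (psi b) :=
  continuous_pi fun _ => (continuous_apply _).comp (b _).continuous_block

/-- **`T_η` is compact** for `η > 0`. [folklore] -/
theorem isCompact_tset [T2Space M] {η : ℝ} (hη : 0 < η) : IsCompact (tset b η) := by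
  rw [tset_eq_iUnion]
  refine isCompact_iUnion fun a => ?_
  exact (b a).isCompact_closedBall.of_isClosed_subset
    (isClosed_le continuous_const (b a).continuous_bump) (tpiece_subset_closedBall b hη a)

/-- The open set `{Q | ∃ a, η < β_a Q}` lies in `T_η`. [folklore] -/
theorem isOpen_setOf_exists_lt [T2Space M] (η : ℝ) : IsOpen {Q : M | ∃ a, η < (b a).bump Q} := by
  have : {Q : M | ∃ a, η < (b a).bump Q} = ⋃ a, {Q | η < (b a).bump Q} := by ext; simp
  rw [this]
  exact isOpen_iUnion fun a => isOpen_lt continuous_const (b a).continuous_bump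

/-- `{∃ a, η < β_a} ⊆ T_η`. [folklore] -/
theorem setOf_exists_lt_subset (η : ℝ) : {Q : M | ∃ a, η < (b a).bump Q} ⊆ tset b η :=
  fun _ ⟨a, ha⟩ => ⟨a, ha.le⟩

/-- `{∃ a, η < β_a} ⊆ interior T_η`. [folklore] -/
theorem setOf_exists_lt_subset_interior [T2Space M] (η : ℝ) :
    {Q : M | ∃ a, η < (b a).bump Q} ⊆ interior (tset b η) :=
  interior_maximal (setOf_exists_lt_subset b η) (isOpen_setOf_exists_lt b η)

/-- **`Ψ` is injective on `T_η`** for `η > 0` (indeed on `{∃ a, β_a > 0}`: the block of a ball with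
`β_a Q > 0` recovers `φ_a Q`). [cite: BochnakCosteRoy1998, §9.2] -/
theorem injOn_psi {η : ℝ} (hη : 0 < η) : InjOn (psi b) (tset b η) := by
  intro Q hQ Q' _ h
  obtain ⟨a, ha⟩ := hQ
  have hpos : 0 < (b a).bump Q := hη.trans_le ha
  have h0 : (b a).bump Q = (b a).bump Q' := by
    have := congrFun h (finSigmaFinEquiv ⟨a, 0⟩)
    rwa [psi_apply, psi_apply, Ball.block_zero, Ball.block_zero] at this
  have hpos' : 0 < (b a).bump Q' := h0 ▸ hpos
  have hQd := (b a).mem_dom_of_bump_pos hpos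
  have hQ'd := (b a).mem_dom_of_bump_pos hpos'
  refine (b a).c.injOn hQd hQ'd (funext fun j => ?_)
  have := congrFun h (finSigmaFinEquiv ⟨a, j.succ⟩)
  rw [psi_apply, psi_apply, Ball.block_succ, Ball.block_succ, ← h0] at this
  have h2 := mul_left_cancel₀ hpos.ne' this
  linarith

/-! ### Semialgebraicity of `Ψ(T_η)` and `Ψ(T_η ∩ Z)` -/

variable [Nonempty M]

omit [Nonempty M] in
/-- The coordinate image of the piece `T_{η,a}`: a polynomial superlevel set in `φ_a(dom_a)`.
[folklore] -/
theorem image_tpiece_eq {η : ℝ} (hη : 0 < η) (a : Fin A) :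
    (b a).c.φ '' tpiece b η a =
      (b a).c.φ '' (b a).c.dom ∩ {w | sumSq (w - (b a).z) ≤ (b a).r - η} := by
  ext w
  constructor
  · rintro ⟨Q, hQ, rfl⟩
    have hQd := tpiece_subset_dom b hη a hQ
    exact ⟨⟨Q, hQd, rfl⟩, ((b a).le_bump_iff hη hQd).1 hQ⟩
  · rintro ⟨⟨Q, hQd, rfl⟩, hw⟩
    exact ⟨Q, ((b a).le_bump_iff hη hQd).2 hw, rfl⟩

omit [Nonempty M] in
/-- The coordinate image of `T_{η,a}` is semialgebraic. [cite: BochnakCosteRoy1998, §2.2] -/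
theorem isSemialgebraic_image_tpiece [Nonempty M] {η : ℝ} (hη : 0 < η) (a : Fin A) :
    IsSemialgebraic ℝ ((b a).c.φ '' tpiece b η a) := by
  rw [image_tpiece_eq b hη a]
  refine (b a).c.isSemialgebraic_image.inter ?_
  have : {w : Fin (b a).c.m → ℝ | sumSq (w - (b a).z) ≤ (b a).r - η} =
      {w | aeval w (sumSqPoly (b a).z) ≤ aeval w (C ((b a).r - η))} := by
    ext w; simp
  rw [this]
  exact isSemialgebraic_setOf_eval_le _ _

variable {b}

/-- **The bump of ball `a'` is a semialgebraic function of the coordinates of chart `a`** on any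
semialgebraic `S ⊆ φ_a(dom_a)` (compatibility of the two charts; `0` off the overlap).
[cite: BochnakCosteRoy1998, Prop. 2.2.6] -/
theorem isSemialgebraicFunOn_bump_inv {a a' : Fin A} (hc : Chart.Compatible (b a).c (b a').c)
    {S : Set (Fin (b a).c.m → ℝ)} (hS : IsSemialgebraic ℝ S) (hSd : S ⊆ (b a).c.φ '' (b a).c.dom) :
    IsSemialgebraicFunOn ℝ S fun w => (b a').bump ((b a).c.inv w) := by
  -- the overlap part of `S`
  have hS₁s : IsSemialgebraic ℝ (S ∩ (b a).c.φ '' ((b a).c.dom ∩ (b a').c.dom)) := hS.inter hc.1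
  have h1 : IsSemialgebraicFunOn ℝ (S ∩ (b a).c.φ '' ((b a).c.dom ∩ (b a').c.dom))
      fun w => (b a').bump ((b a).c.inv w) := by
    -- on the overlap, `bump = max 0 (r' - Σ (φ'_j ∘ inv - z'_j)²)`
    have hcoord : ∀ j, IsSemialgebraicFunOn ℝ (S ∩ (b a).c.φ '' ((b a).c.dom ∩ (b a').c.dom))
        fun w => (b a').c.φ ((b a).c.inv w) j := fun j =>
      (hc.isSemialgebraicFunOn_apply j).mono inter_subset_right hS₁s
    have hsum : IsSemialgebraicFunOn ℝ (S ∩ (b a).c.φ '' ((b a).c.dom ∩ (b a').c.dom))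
        fun w => sumSq ((b a').c.φ ((b a).c.inv w) - (b a').z) := by
      unfold sumSq
      refine isSemialgebraicFunOn_finset_sum hS₁s Finset.univ _ fun j _ => ?_
      have h := saFun_sub (hcoord j) (isSemialgebraicFunOn_const hS₁s ((b a').z j))
      simpa [pow_two] using saFun_mul h h
    have hu : IsSemialgebraicFunOn ℝ (S ∩ (b a).c.φ '' ((b a).c.dom ∩ (b a').c.dom))
        fun w => (b a').r - sumSq ((b a').c.φ ((b a).c.inv w) - (b a').z) :=
      saFun_sub (isSemialgebraicFunOn_const hS₁s _) hsum
    refine (saFun_posPart hS₁s hu).congr fun w hw => ?_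
    have hwd : (b a).c.inv w ∈ (b a').c.dom := by
      obtain ⟨Q, hQ, hQw⟩ := hw.2
      rw [← hQw, (b a).c.inv_apply hQ.1]; exact hQ.2
    simp only [(b a').bump_of_mem hwd, Ball.bumpCoord]
  refine saFun_of_eq_zero_off hS hS₁s h1 (fun w hw hw1 => ?_) inter_subset_left
  apply (b a').bump_of_not_mem
  intro hwd
  obtain ⟨hd, hφ⟩ := (b a).c.inv_mem (hSd hw)
  exact hw1 ⟨hw, (b a).c.inv w, ⟨hd, hwd⟩, hφ⟩

/-- **The weighted coordinates of ball `a'` are semialgebraic functions of the coordinates of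
chart `a`.** [cite: BochnakCosteRoy1998, Prop. 2.2.6] -/
theorem isSemialgebraicFunOn_bump_mul_inv {a a' : Fin A} (hc : Chart.Compatible (b a).c (b a').c)
    {S : Set (Fin (b a).c.m → ℝ)} (hS : IsSemialgebraic ℝ S) (hSd : S ⊆ (b a).c.φ '' (b a).c.dom)
    (j : Fin (b a').c.m) :
    IsSemialgebraicFunOn ℝ S fun w =>
      (b a').bump ((b a).c.inv w) * ((b a').c.φ ((b a).c.inv w) j - (b a').z j) := by
  have hS₁s : IsSemialgebraic ℝ (S ∩ (b a).c.φ '' ((b a).c.dom ∩ (b a').c.dom)) := hS.inter hc.1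
  have h1 : IsSemialgebraicFunOn ℝ (S ∩ (b a).c.φ '' ((b a).c.dom ∩ (b a').c.dom)) fun w =>
      (b a').bump ((b a).c.inv w) * ((b a').c.φ ((b a).c.inv w) j - (b a').z j) :=
    saFun_mul ((isSemialgebraicFunOn_bump_inv hc hS hSd).mono inter_subset_left hS₁s)
      (saFun_sub ((hc.isSemialgebraicFunOn_apply j).mono inter_subset_right hS₁s)
        (isSemialgebraicFunOn_const hS₁s _))
  refine saFun_of_eq_zero_off hS hS₁s h1 (fun w hw hw1 => ?_) inter_subset_left
  have : (b a').bump ((b a).c.inv w) = 0 := by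
    apply (b a').bump_of_not_mem
    intro hwd
    obtain ⟨hd, hφ⟩ := (b a).c.inv_mem (hSd hw)
    exact hw1 ⟨hw, (b a).c.inv w, ⟨hd, hwd⟩, hφ⟩
  rw [this, zero_mul]

/-- **`Ψ ∘ φ_a⁻¹` is a semialgebraic map** on any semialgebraic `S ⊆ φ_a(dom_a)`, provided chart
`a` is compatible with all charts. [cite: BochnakCosteRoy1998, Prop. 2.2.6] -/
theorem isSemialgebraicMapOn_psi_inv {a : Fin A} (hc : ∀ a', Chart.Compatible (b a).c (b a').c)
    {S : Set (Fin (b a).c.m → ℝ)} (hS : IsSemialgebraic ℝ S) (hSd : S ⊆ (b a).c.φ '' (b a).c.dom) :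
    IsSemialgebraicMapOn ℝ S (psi b ∘ (b a).c.inv) := by
  refine IsSemialgebraicMapOn.of_forall hS fun k => ?_
  obtain ⟨⟨a', i⟩, rfl⟩ := finSigmaFinEquiv.surjective k
  simp only [comp_apply, psi_apply]
  refine Fin.cases ?_ (fun j => ?_) i
  · simpa using isSemialgebraicFunOn_bump_inv (hc a') hS hSd
  · simpa using isSemialgebraicFunOn_bump_mul_inv (hc a') hS hSd j

variable (b)

/-- **`Ψ(T_η)` is semialgebraic** (`η > 0`, all charts pairwise compatible).
[cite: BochnakCosteRoy1998, Prop. 2.2.7] -/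
theorem isSemialgebraic_image_psi (hc : ∀ a a', Chart.Compatible (b a).c (b a').c) {η : ℝ} (hη : 0 < η) :
    IsSemialgebraic ℝ (psi b '' tset b η) := by
  rw [tset_eq_iUnion, image_iUnion]
  have : (⋃ a, psi b '' tpiece b η a) = ⋃ a ∈ (Finset.univ : Finset (Fin A)), psi b '' tpiece b η a := by
    simp
  rw [this]
  refine IsSemialgebraic.biUnion _ _ fun a _ => ?_
  rw [(b a).c.image_eq_image_inv (psi b) (tpiece_subset_dom b hη a)]
  have hS := isSemialgebraic_image_tpiece b hη a
  have hSd : (b a).c.φ '' tpiece b η a ⊆ (b a).c.φ '' (b a).c.dom := image_mono (tpiece_subset_dom b hη a)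
  exact IsSemialgebraicMapOn.isSemialgebraic_image_holds (isSemialgebraicMapOn_psi_inv (hc a) hS hSd)
    Subset.rfl hS

/-- **`Ψ(T_η ∩ Z)` is semialgebraic** for a subset `Z` whose trace on every chart is semialgebraic
in coordinates. [cite: BochnakCosteRoy1998, Prop. 2.2.7] -/
theorem isSemialgebraic_image_psi_inter (hc : ∀ a a', Chart.Compatible (b a).c (b a').c) {η : ℝ}
    (hη : 0 < η) {Z : Set M} (hZ : ∀ a, IsSemialgebraic ℝ ((b a).c.φ '' ((b a).c.dom ∩ Z))) :
    IsSemialgebraic ℝ (psi b '' (tset b η ∩ Z)) := by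
  have hT : tset b η ∩ Z = ⋃ a ∈ (Finset.univ : Finset (Fin A)), tpiece b η a ∩ Z := by
    rw [tset_eq_iUnion, iUnion_inter]; simp
  rw [hT, image_iUnion₂]
  refine IsSemialgebraic.biUnion _ _ fun a _ => ?_
  have hsub : tpiece b η a ∩ Z ⊆ (b a).c.dom := fun Q hQ => tpiece_subset_dom b hη a hQ.1
  rw [(b a).c.image_eq_image_inv (psi b) hsub]
  have hS := isSemialgebraic_image_tpiece b hη a
  have hSd : (b a).c.φ '' tpiece b η a ⊆ (b a).c.φ '' (b a).c.dom := image_mono (tpiece_subset_dom b hη a)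
  have heq : (b a).c.φ '' (tpiece b η a ∩ Z) =
      (b a).c.φ '' tpiece b η a ∩ (b a).c.φ '' ((b a).c.dom ∩ Z) := by
    have h1 : tpiece b η a ∩ Z = tpiece b η a ∩ ((b a).c.dom ∩ Z) := by
      ext Q
      constructor
      · rintro ⟨h, hZ'⟩; exact ⟨h, tpiece_subset_dom b hη a h, hZ'⟩
      · rintro ⟨h, -, hZ'⟩; exact ⟨h, hZ'⟩
    rw [h1]
    exact (b a).c.injOn.image_inter (tpiece_subset_dom b hη a) inter_subset_left
  have hSZ : IsSemialgebraic ℝ ((b a).c.φ '' (tpiece b η a ∩ Z)) := by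
    rw [heq]; exact hS.inter (hZ a)
  exact IsSemialgebraicMapOn.isSemialgebraic_image_holds (isSemialgebraicMapOn_psi_inv (hc a) hS hSd)
    (by rw [heq]; exact inter_subset_left) hSZ

end Model

/-! ### The packaged statement -/

/-- **Compact semialgebraic models from a finite compatible atlas.** Let `M` be Hausdorff,
`b : Fin A → Ball M` balls in pairwise compatible charts, `Z ⊆ M` chartwise semialgebraic, and
`η > 0`. Then `T = {Q | ∃ a, η ≤ β_a Q}` is a compact set containing the open set
`{Q | ∃ a, η < β_a Q}`, and `Ψ = psi b : M → ℝᴺ` is continuous, injective on `T`, with `Ψ(T)` and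
`Ψ(T ∩ Z)` semialgebraic. [cite: BochnakCosteRoy1998, Prop. 2.2.7 and §9.2] -/
theorem exists_model [T2Space M] {A : ℕ} (b : Fin A → Ball M)
    (hc : ∀ a a', Chart.Compatible (b a).c (b a').c) {Z : Set M}
    (hZ : ∀ a, IsSemialgebraic ℝ ((b a).c.φ '' ((b a).c.dom ∩ Z))) {η : ℝ} (hη : 0 < η) :
    IsCompact (tset b η) ∧ IsOpen {Q : M | ∃ a, η < (b a).bump Q} ∧
      {Q : M | ∃ a, η < (b a).bump Q} ⊆ tset b η ∧ Continuous (psi b) ∧ InjOn (psi b) (tset b η) ∧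
      IsSemialgebraic ℝ (psi b '' tset b η) ∧ IsSemialgebraic ℝ (psi b '' (tset b η ∩ Z)) := by
  refine ⟨isCompact_tset b hη, isOpen_setOf_exists_lt b η, setOf_exists_lt_subset b η,
    continuous_psi b, injOn_psi b hη, ?_, ?_⟩
  · cases isEmpty_or_nonempty M with
    | inl h =>
      rw [Set.eq_empty_of_isEmpty (tset b η), image_empty]
      exact isSemialgebraic_empty
    | inr h => exact isSemialgebraic_image_psi b hc hη
  · cases isEmpty_or_nonempty M with
    | inl h =>
      rw [Set.eq_empty_of_isEmpty (tset b η ∩ Z), image_empty]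
      exact isSemialgebraic_empty
    | inr h => exact isSemialgebraic_image_psi_inter b hc hη hZ

end SemialgAtlas

end Literature.ModelTheory.ExponentialFields

end
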